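import Mathlib.NumberTheory.Padics.RingHoms
import Mathlib.RingTheory.Filtration
import Mathlib.Topology.Algebra.Module.Basic
import HarnessLib

/-!
# Additive maps into `p`-adically separated `ℤ_p`-modules are automatically `ℤ_p`-linear

Let `p` be a prime, `M` ANY `ℤ_p`-module and `N` a `ℤ_p`-module which is `p`-ADICALLY SEPARATED,
i.e. `⋂_k p^k N = 0` (for instance `N` finitely generated over `ℤ_p` — Krull's intersection theorem —
in particular `N = ℤ_p^n`, `N = ℤ_p`). Then every ADDITIVE map `f : M →+ N` is `ℤ_p`-linear:
`f (c • x) = c • f x` for all `c : ℤ_p`.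

Proof: for fixed `x` the map `g(c) := f(c • x) - c • f(x)` is additive in `c` and vanishes on the image
of `ℤ`; writing `c = appr c k + p^k • y` (Mathlib `PadicInt.appr_spec`) gives `g(c) = p^k • g(y) ∈ p^k N`
for every `k`, whence `g(c) = 0` by separatedness. No topology on `M` or `N` is used.

This generalises the rank-one statement `End_ℤ(ℤ_p) = ℤ_p` of the sibling file
`Literature/Algebra/Module/PadicProductEndomorphisms.lean` (`addMonoidHom_apply_eq_mul`) to the LATTICE case
needed when a group-theoretically reconstructed map between unit groups of `p`-adic local fields — an
abstract homomorphism `𝒪_K^× → 𝒪_{K'}^×`, or its logarithm `log(𝒪_K^×) → log(𝒪_{K'}^×)` between free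
`ℤ_p`-modules of rank `[K : ℚ_p]` — has to be compared with the `ℤ_p`-module (or `Ẑ^×`-power) structure:
such a map is `ℤ_p`-linear for free. Consequences recorded: `IsLinearMap` forms, the finitely generated /
finite free / rank-one specialisations, `f c = c • f 1` for `f : ℤ_p →+ N`, equality of additive maps out of
`ℤ_p` that agree at `1`, and continuity of every additive map `ℤ_p^m → ℤ_p^n` (the case `G = ℤ_p^m` of
[cite: DixonEtAl1999, Cor 1.21 (i)] «every abstract homomorphism from a finitely generated pro-`p` group to a
profinite group is continuous», proved here elementarily). Sources: Fuchs, *Infinite Abelian Groups* I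
[cite: Fuchs1970, §43 Example 5] (`Hom(J_p, J_p) ≅ J_p`: «`Z ⊆ Ker`, divisibility of `J_p/Z`, reducedness of
`J_p`» — the argument formalised here verbatim with a general separated target), Atiyah–Macdonald
[cite: AtiyahMacdonald1969, Cor 10.19] (Krull's intersection theorem), Dixon–du Sautoy–Mann–Segal (loc. cit.).

The separatedness hypothesis cannot be dropped: `ℚ_p` is a `ℤ_p`-module with `⋂_k p^k ℚ_p = ℚ_p`, and a
discontinuous `ℚ`-linear endomorphism of `ℚ_p` (Hamel basis) is additive but not `ℤ_p`-linear. What is NOT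
here: the multiplicative / `Ẑ`-versions (compose with `Multiplicative`/`Additive` and the CRT decomposition
`Ẑ = ∏_p ℤ_p` of the sibling file as needed).
-/

namespace Literature.Algebra.Module.PadicAdditiveLinear

variable {p : ℕ} [Fact p.Prime]
variable {M N : Type*} [AddCommGroup M] [Module ℤ_[p] M] [AddCommGroup N] [Module ℤ_[p] N]

/-! ### The key computation: an additive map out of `ℤ_p` killing `ℤ` lands in `⋂_k p^k N` -/

/-- An additive map `g : ℤ_p →+ N` into a `ℤ_p`-module which vanishes on (the image of) `ℕ` takes every value
inside `p^k N` for every `k`: write `c = appr c k + p^k · y`, so `g c = p^k • g y` (the step «`Z ⊆ Ker ξ` and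
`J_p/Z` is divisible» of Fuchs's computation `Hom(J_p, J_p) = J_p`, run inside an arbitrary `ℤ_p`-module).
[cite: Fuchs1970, §43 Example 5] -/
theorem map_mem_pow_smul_top_of_map_natCast_eq_zero (g : ℤ_[p] →+ N) (hg : ∀ n : ℕ, g n = 0)
    (c : ℤ_[p]) (k : ℕ) :
    g c ∈ ((Ideal.span {(p : ℤ_[p])}) ^ k • ⊤ : Submodule ℤ_[p] N) := by
  obtain ⟨y, hy⟩ := Ideal.mem_span_singleton'.mp (PadicInt.appr_spec k c)
  have hc : c = ((c.appr k : ℕ) : ℤ_[p]) + ((p : ℤ_[p]) ^ k) • y := by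
    rw [smul_eq_mul, mul_comm, hy]; ring
  have hsmul : g (((p : ℤ_[p]) ^ k) • y) = ((p : ℤ_[p]) ^ k) • g y := by
    rw [← Nat.cast_pow, Nat.cast_smul_eq_nsmul, map_nsmul, ← Nat.cast_smul_eq_nsmul ℤ_[p], Nat.cast_pow]
  rw [hc, map_add, hg, zero_add, hsmul]
  exact Submodule.smul_mem_smul (Ideal.pow_mem_pow (Ideal.mem_span_singleton_self _) k) Submodule.mem_top

/-- An additive map `g : ℤ_p →+ N` vanishing on `ℕ` takes values in `⋂_k p^k N` (loc. cit.: «because of the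
divisibility of `J_p/Z`»). [cite: Fuchs1970, §43 Example 5] -/
theorem map_mem_iInf_pow_smul_top_of_map_natCast_eq_zero (g : ℤ_[p] →+ N) (hg : ∀ n : ℕ, g n = 0)
    (c : ℤ_[p]) :
    g c ∈ (⨅ k : ℕ, (Ideal.span {(p : ℤ_[p])}) ^ k • ⊤ : Submodule ℤ_[p] N) :=
  (Submodule.mem_iInf _).mpr fun k => map_mem_pow_smul_top_of_map_natCast_eq_zero g hg c k

/-! ### Automatic linearity into `p`-adically separated modules -/

/-- **Additive maps into a `p`-adically separated `ℤ_p`-module are `ℤ_p`-linear.** If `⋂_k p^k N = 0` then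
every additive `f : M →+ N` (with `M` an arbitrary `ℤ_p`-module) satisfies `f (c • x) = c • f x` — Fuchs's
argument for `Hom(J_p, J_p) = J_p` («divisibility of `J_p/Z` and reducedness of `J_p`») with reducedness replaced by
separatedness of the target. [cite: Fuchs1970, §43 Example 5] -/
theorem map_smul_of_iInf_pow_smul_top_eq_bot
    (hN : (⨅ k : ℕ, (Ideal.span {(p : ℤ_[p])}) ^ k • ⊤ : Submodule ℤ_[p] N) = ⊥)
    (f : M →+ N) (c : ℤ_[p]) (x : M) : f (c • x) = c • f x := by
  -- `g c := f (c • x) - c • f x` is additive in `c` and vanishes on `ℕ`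
  let g : ℤ_[p] →+ N := f.comp ((smulAddHom ℤ_[p] M).flip x) - (smulAddHom ℤ_[p] N).flip (f x)
  have hg_apply : ∀ c : ℤ_[p], g c = f (c • x) - c • f x := fun c => rfl
  have hg : ∀ n : ℕ, g n = 0 := by
    intro n
    rw [hg_apply, Nat.cast_smul_eq_nsmul, Nat.cast_smul_eq_nsmul, map_nsmul, sub_self]
  have hmem := map_mem_iInf_pow_smul_top_of_map_natCast_eq_zero g hg c
  rw [hN, Submodule.mem_bot, hg_apply, sub_eq_zero] at hmem
  exact hmem

/-- `IsLinearMap` form of `map_smul_of_iInf_pow_smul_top_eq_bot`: an additive map into a `p`-adically separated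
`ℤ_p`-module IS a `ℤ_p`-linear map (use `IsLinearMap.mk'` to obtain the bundled `M →ₗ[ℤ_[p]] N`).
[cite: Fuchs1970, §43 Example 5] -/
theorem isLinearMap_of_iInf_pow_smul_top_eq_bot
    (hN : (⨅ k : ℕ, (Ideal.span {(p : ℤ_[p])}) ^ k • ⊤ : Submodule ℤ_[p] N) = ⊥) (f : M →+ N) :
    IsLinearMap ℤ_[p] f :=
  ⟨f.map_add, map_smul_of_iInf_pow_smul_top_eq_bot hN f⟩

/-! ### Finitely generated targets (Krull's intersection theorem) -/

/-- A finitely generated `ℤ_p`-module is `p`-adically separated: `⋂_k p^k N = 0` (Krull's intersection theorem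
for the Noetherian local ring `ℤ_p`, Mathlib `Ideal.iInf_pow_smul_eq_bot_of_isLocalRing`).
[cite: AtiyahMacdonald1969, Cor 10.19] -/
theorem iInf_pow_smul_top_eq_bot_of_finite [Module.Finite ℤ_[p] N] :
    (⨅ k : ℕ, (Ideal.span {(p : ℤ_[p])}) ^ k • ⊤ : Submodule ℤ_[p] N) = ⊥ :=
  Ideal.iInf_pow_smul_eq_bot_of_isLocalRing _ fun h =>
    PadicInt.irreducible_p.not_isUnit (Ideal.span_singleton_eq_top.mp h)

/-- **Additive maps into a finitely generated `ℤ_p`-module are `ℤ_p`-linear**: `f (c • x) = c • f x` for every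
additive `f : M →+ N`, `N` finitely generated over `ℤ_p`, `M` arbitrary (Fuchs's `Hom(J_p, J_p) = J_p` argument +
Krull). [cite: Fuchs1970, §43 Example 5] -/
theorem map_smul_of_finite [Module.Finite ℤ_[p] N] (f : M →+ N) (c : ℤ_[p]) (x : M) :
    f (c • x) = c • f x :=
  map_smul_of_iInf_pow_smul_top_eq_bot iInf_pow_smul_top_eq_bot_of_finite f c x

/-- `IsLinearMap` form: an additive map into a finitely generated `ℤ_p`-module is `ℤ_p`-linear.
[cite: Fuchs1970, §43 Example 5] -/
theorem isLinearMap_of_finite [Module.Finite ℤ_[p] N] (f : M →+ N) : IsLinearMap ℤ_[p] f :=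
  ⟨f.map_add, map_smul_of_finite f⟩

/-- The bundled linear map of `isLinearMap_of_finite` agrees with `f` pointwise (so nothing is lost in passing
from `f` to `IsLinearMap.mk' f _`). [cite: Fuchs1970, §43 Example 5] -/
theorem mk'_isLinearMap_of_finite_apply [Module.Finite ℤ_[p] N] (f : M →+ N) (x : M) :
    IsLinearMap.mk' f (isLinearMap_of_finite (p := p) f) x = f x :=
  rfl

/-! ### Free targets of finite rank, and the rank-one case -/

/-- **Every additive map `M →+ ℤ_p^ι` (`ι` finite) is `ℤ_p`-linear** (lattice form of `Hom(J_p, J_p) = J_p`).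
[cite: Fuchs1970, §43 Example 5] -/
theorem map_smul_pi {ι : Type*} [Finite ι] (f : M →+ (ι → ℤ_[p])) (c : ℤ_[p]) (x : M) :
    f (c • x) = c • f x :=
  map_smul_of_finite f c x

/-- **Every additive map `M →+ ℤ_p` is `ℤ_p`-linear** (for `M = ℤ_p` this is exactly `Hom(J_p, J_p) = J_p`).
[cite: Fuchs1970, §43 Example 5] -/
theorem map_smul_self (f : M →+ ℤ_[p]) (c : ℤ_[p]) (x : M) : f (c • x) = c * f x :=
  map_smul_of_finite f c x

/-- An additive map OUT OF `ℤ_p` into a finitely generated `ℤ_p`-module is `c ↦ c • f 1` (the lattice version of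
Fuchs's `End(J_p) = J_p`: «if `ξ 1 = π` then `ξ = η(π)`»). [cite: Fuchs1970, §43 Example 5] -/
theorem apply_eq_smul_map_one [Module.Finite ℤ_[p] N] (f : ℤ_[p] →+ N) (c : ℤ_[p]) : f c = c • f 1 := by
  rw [← map_smul_of_finite f c 1, smul_eq_mul, mul_one]

/-- Two additive maps `ℤ_p →+ N` into a finitely generated `ℤ_p`-module that agree at `1` are equal («different
`p`-adic integers yield different endomorphisms, since they have different effects on `1`»). [cite: Fuchs1970, §43 Example 5] -/
theorem ext_of_map_one_eq [Module.Finite ℤ_[p] N] {f g : ℤ_[p] →+ N} (h : f 1 = g 1) : f = g := by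
  ext c
  rw [apply_eq_smul_map_one f, apply_eq_smul_map_one g, h]

/-- Two additive maps `M →+ N` into a finitely generated `ℤ_p`-module that agree on a set spanning `M` over `ℤ_p`
are equal (they are `ℤ_p`-linear). [cite: Fuchs1970, §43 Example 5] -/
theorem ext_on_span [Module.Finite ℤ_[p] N] {s : Set M} (hs : Submodule.span ℤ_[p] s = ⊤) {f g : M →+ N}
    (h : Set.EqOn f g s) : f = g := by
  have := LinearMap.ext_on (hv := hs) (f := IsLinearMap.mk' f (isLinearMap_of_finite (p := p) f))
    (g := IsLinearMap.mk' g (isLinearMap_of_finite (p := p) g)) h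
  ext x
  exact congrArg (fun φ : M →ₗ[ℤ_[p]] N => φ x) this

/-! ### Continuity of abstract homomorphisms between finite free `ℤ_p`-modules -/

/-- **Every additive map `ℤ_p^ι → ℤ_p^κ` (`ι`, `κ` finite) is continuous** — it is `ℤ_p`-linear by
`map_smul_pi`, and linear maps out of a finite free module over a topological ring are continuous. This is the
case `G = ℤ_p^m` of «in a topologically finitely generated profinite group every finite-index subgroup is open,
so every abstract homomorphism to a profinite group is continuous», proved here without that theorem.
[cite: DixonEtAl1999, Cor 1.21 (i)] -/
theorem continuous_addMonoidHom_pi {ι κ : Type*} [Finite ι] [Finite κ] (f : (ι → ℤ_[p]) →+ (κ → ℤ_[p])) :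
    Continuous f :=
  (IsLinearMap.mk' f (isLinearMap_of_finite (p := p) f)).continuous_on_pi

/-- Every additive map `ℤ_p^ι → ℤ_p` (`ι` finite) is continuous. [cite: DixonEtAl1999, Cor 1.21 (i)] -/
theorem continuous_addMonoidHom_pi_self {ι : Type*} [Finite ι] (f : (ι → ℤ_[p]) →+ ℤ_[p]) :
    Continuous f :=
  (IsLinearMap.mk' f (isLinearMap_of_finite (p := p) f)).continuous_on_pi

/-- Every additive map `ℤ_p → N` into a finitely generated topological `ℤ_p`-module with continuous scalar
multiplication is continuous (it is `c ↦ c • f 1`). [cite: DixonEtAl1999, Cor 1.21 (i)] -/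
theorem continuous_addMonoidHom_of_finite [Module.Finite ℤ_[p] N] [TopologicalSpace N] [ContinuousSMul ℤ_[p] N]
    (f : ℤ_[p] →+ N) : Continuous f := by
  have : (f : ℤ_[p] → N) = fun c => c • f 1 := funext (apply_eq_smul_map_one f)
  rw [this]
  exact continuous_id.smul continuous_const

end Literature.Algebra.Module.PadicAdditiveLinear
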